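import Mathlib.Algebra.MvPolynomial.Degrees
import Mathlib.Data.ZMod.Basic
import Mathlib.Data.Nat.Prime.Defs
import Literature.Computability.Complexity.BoolEncodings
import Literature.Computability.Complexity.Classes
import Literature.Computability.Complexity.Oracle
import HarnessLib

-- provenance: harness21/H21/H21/Prelude/CplxCore/Algebrization.lean @ 6de89a0 (interim HEAD d8f2665); M5 mechanical rewrite
/-!
# Complexity core: algebrization (low-degree extension oracles)

Trunk `CplxCore`, concept C18 (`Algebrization`; realises the notion
`algebraic_oracle_extension`). Aaronson–Wigderson (2009) refine relativization: an inclusion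
`C ⊆ D` *algebrizes* if `C^A ⊆ D^Ã` for every oracle language `A` and every low-degree
extension `Ã` of `A` over finite fields; a separation `C ⊄ D` algebrizes if `C^Ã ⊄ D^A` for all
such `A, Ã`.

## Contents

* `ExtensionOracle`: a family of polynomials `Ã p n ∈ 𝔽_p[x₁, …, xₙ]`, one for every prime `p`
  and arity `n` (indexed by Mathlib's `Nat.Primes`, so there are no unconstrained junk
  components).
* `ExtensionOracle.IsExtensionOf Ã A d`: every `Ã p n` has multidegree `≤ d`
  (`MvPolynomial.degreeOf`) and agrees with the Boolean slice `A.sliceFn n` on `{0,1}ⁿ`.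
* `encodingExtQuery`: the Boolean encoding of extension queries `(p, n, x ∈ ℕⁿ)`, built from
  the C2 combinators `sigmaBool`, `listBool encodingNatBool`.
* `ExtensionOracle.toOracle Ã : Oracle`: decode a query; malformed queries and non-prime `p`
  are answered `[]`; otherwise the answer is the binary encoding of `Ã p n (x mod p) ∈ 𝔽_p`
  (as a natural number `< p` via `ZMod.val`).
* `IsAlgebrizingInclusion`, `IsAlgebrizingSeparation`: the two notions of AW 2009, Def. 1.2,
  for relativised classes `C D : Oracle → Set (Language Bool)` (e.g. `PRel`, `NPRel`).
* API: `exists_isExtensionOf_one` (the multilinear extension), `toOracle_of_not_prime`,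
  `toOracle_decode_none`, `toOracle_spec`.

## Design notes

* Mathlib has `MvPolynomial`, `MvPolynomial.eval`, `MvPolynomial.degreeOf`, `ZMod`,
  `Nat.Primes` (all reused); it has no notion of oracle extension or algebrization (grep for
  `algebriz`, `ExtensionOracle`, `multilinear extension` finds nothing relevant).
* v0 restricts Aaronson–Wigderson's "all finite fields `𝔽`" to the prime fields `ZMod p`
  (outline R7); this is the variant used for most of AW's results (their §5 needs only prime
  fields as well) and avoids carrying a `Field`/`Fintype` structure inside query strings.
* The whole answer string of `toOracle` is `encodeNat v` (as for `Oracle.ofFun`), so the fact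
  `encodeNat 0 = []` is harmless: no further field follows it. In particular the answer `[]`
  on malformed queries coincides with the answer for the value `0`; algorithms may test
  primality of `p` themselves (in polynomial time), so no information is smuggled through
  malformed queries (REVIEW F6).
* Universes: everything lives in `Type`.

## References

* S. Aaronson, A. Wigderson, *Algebrization: a new barrier in complexity theory*, ACM TOCT 1
  (2009), Def. 1.1 (extension oracle), Def. 1.2 (algebrizing inclusions/separations), §4.1
  (multilinear extensions).
* S. Arora, B. Barak, *Computational Complexity: A Modern Approach*, CUP 2009, §3.4 (oracles).
-/

namespace Literature.Computability.Complexity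

open _root_.Computability

/-! ### Extension oracles -/

/-- An *extension oracle* (candidate): for every prime `p` and every arity `n`, a polynomial
`Ã p n ∈ 𝔽_p[x₀, …, xₙ₋₁]` (`MvPolynomial (Fin n) (ZMod p)`). Whether it actually extends a
given Boolean oracle `A` with low degree is the predicate `ExtensionOracle.IsExtensionOf`.
Indexed by `Nat.Primes`, so every component is meaningful (v0: prime fields only).
[Aaronson–Wigderson 2009, Def. 1.1] [cite: AaronsonWigderson2009, Def. 1.1] -/
structure ExtensionOracle where
  /-- The polynomial over `𝔽_p` in `n` variables answering queries in `𝔽_pⁿ`. -/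
  poly : ∀ (p : Nat.Primes) (n : ℕ), MvPolynomial (Fin n) (ZMod p)

namespace ExtensionOracle

/-- `Ã.IsExtensionOf A d`: `Ã` is an extension of the language `A ⊆ {0,1}*` of (multi)degree at
most `d`, i.e. for every prime `p` and arity `n`, the polynomial `Ã p n` has degree `≤ d` in
each variable and coincides with the characteristic function of `A ∩ {0,1}ⁿ`
(`Language.sliceFn A n`) on Boolean inputs. [Aaronson–Wigderson 2009, Def. 1.1] [cite: AaronsonWigderson2009, Def. 1.1] -/
def IsExtensionOf (Ã : ExtensionOracle) (A : Language Bool) (d : ℕ) : Prop :=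
  ∀ (p : Nat.Primes) (n : ℕ),
    (∀ i : Fin n, (Ã.poly p n).degreeOf i ≤ d) ∧
    ∀ x : Fin n → Bool,
      MvPolynomial.eval (fun i => if x i then (1 : ZMod p) else 0) (Ã.poly p n) =
        if A.sliceFn n x then 1 else 0

/-- Monotonicity of the degree bound: an extension of multidegree `≤ d` is one of multidegree
`≤ d'` for `d ≤ d'`. [Aaronson–Wigderson 2009, Def. 1.1] [cite: AaronsonWigderson2009, Def. 1.1] -/
theorem IsExtensionOf.mono {Ã : ExtensionOracle} {A : Language Bool} {d d' : ℕ}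
    (h : Ã.IsExtensionOf A d) (hd : d ≤ d') : Ã.IsExtensionOf A d' :=
  fun p n => ⟨fun i => ((h p n).1 i).trans hd, (h p n).2⟩

end ExtensionOracle

/-! ### Encoding of extension queries -/

/-- Vectors `Fin n → ℕ` over `Bool`: encode `List.ofFn x` with `encodingListNatBool`
(`encodingNatBool.listBool`); decoding checks the length. [Arora–Barak 2009, §0.1] [cite: AroraBarak2009, §0.1] -/
def encodingNatVec (n : ℕ) : Encoding (Fin n → ℕ) Bool where
  encode x := encodingListNatBool.encode (List.ofFn x)
  decode w := (encodingListNatBool.decode w).bind fun l =>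
    if h : l.length = n then some (fun i => l.get (i.cast h.symm)) else none
  decode_encode x := by
    rw [encodingListNatBool.decode_encode]
    simp only [Option.bind_some, List.length_ofFn, dite_true, Option.some.injEq]
    funext i
    simp

/-- Extension queries `(p, n, x)` with `x ∈ ℕⁿ` (to be read modulo `p`) over `Bool`:
`boolPair (encodeNat p) (boolPair (encodeNat n) (encodingNatVec n x))`, via the C2 combinator
`sigmaBool` twice. [Aaronson–Wigderson 2009, Def. 1.1; Arora–Barak 2009, §0.1] [cite: AaronsonWigderson2009, Def. 1.1] -/
def encodingExtQuery : Encoding (Σ _ : ℕ, Σ n : ℕ, Fin n → ℕ) Bool :=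
  Encoding.sigmaBool fun _ => Encoding.sigmaBool encodingNatVec

namespace ExtensionOracle

/-- The answer of the extension oracle `Ã` on a decoded query `(p, n, x)`: `[]` if `p` is not
prime, otherwise the binary encoding of the residue `Ã p n (x mod p) ∈ 𝔽_p`, read as a natural
number `< p` (`ZMod.val`). [Aaronson–Wigderson 2009, Def. 1.1] [cite: AaronsonWigderson2009, Def. 1.1] -/
noncomputable def answer (Ã : ExtensionOracle) (p n : ℕ) (x : Fin n → ℕ) : List Bool :=
  if hp : p.Prime then
    encodeNat (ZMod.val (MvPolynomial.eval (fun i => (x i : ZMod p)) (Ã.poly ⟨p, hp⟩ n)))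
  else []

/-- The Boolean oracle `{0,1}* → {0,1}*` presented by an extension oracle `Ã`: decode the query
with `encodingExtQuery`; malformed queries and queries with non-prime modulus are answered
`[]`; a well-formed query `(p, n, x)` is answered by `encodeNat (Ã p n (x mod p)).val`.
[Aaronson–Wigderson 2009, Def. 1.1 (machines with oracle access to `Ã`)] [cite: AaronsonWigderson2009, Def. 1.1 (machines with oracle access to] -/
noncomputable def toOracle (Ã : ExtensionOracle) : Oracle := fun q =>
  match encodingExtQuery.decode q with
  | none => []
  | some ⟨p, n, x⟩ => Ã.answer p n x

/-- Malformed queries are answered `[]`. [H21 outline C18, REVIEW F6] [folklore] -/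
theorem toOracle_of_decode_eq_none (Ã : ExtensionOracle) {q : List Bool}
    (h : encodingExtQuery.decode q = none) : Ã.toOracle q = [] := by
  simp [toOracle, h]

/-- Queries with a non-prime modulus are answered `[]`. [H21 outline C18, REVIEW F6] [folklore] -/
theorem toOracle_of_not_prime (Ã : ExtensionOracle) {p : ℕ} (hp : ¬ p.Prime) (n : ℕ)
    (x : Fin n → ℕ) : Ã.toOracle (encodingExtQuery.encode ⟨p, n, x⟩) = [] := by
  simp [toOracle, encodingExtQuery.decode_encode, answer, hp]

/-- Specification of the extension oracle on well-formed queries: for a prime `p`, the query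
`(p, n, x)` is answered by the binary encoding of `Ã p n (x mod p) ∈ 𝔽_p`.
[Aaronson–Wigderson 2009, Def. 1.1] [cite: AaronsonWigderson2009, Def. 1.1] -/
theorem toOracle_spec (Ã : ExtensionOracle) (p : Nat.Primes) (n : ℕ) (x : Fin n → ℕ) :
    Ã.toOracle (encodingExtQuery.encode ⟨p, n, x⟩) =
      encodeNat (ZMod.val (MvPolynomial.eval (fun i => (x i : ZMod p)) (Ã.poly p n))) := by
  simp only [toOracle, encodingExtQuery.decode_encode, answer, p.2, dite_true]
  rfl

end ExtensionOracle

/-! ### Existence of low-degree extensions -/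

/-- Every language has a *multilinear* extension over every prime field: for each `n`, the
unique multilinear polynomial `Σ_{a ∈ {0,1}ⁿ} [a ∈ A] · Π_i (aᵢ xᵢ + (1 - aᵢ)(1 - xᵢ))` agrees
with `A ∩ {0,1}ⁿ` on the cube and has degree `≤ 1` in each variable.
[Aaronson–Wigderson 2009, §4.1] [cite: AaronsonWigderson2009, §4.1] -/
def exists_isExtensionOf_one : Prop :=
  ∀ (A : Language Bool),
    ∃ Ã : ExtensionOracle, Ã.IsExtensionOf A 1

/-! ### Algebrizing inclusions and separations -/

/-- The inclusion `C ⊆ D` of relativisable classes *algebrizes* if `C^A ⊆ D^Ã` for every oracle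
language `A` and every low-degree extension `Ã` of `A` (any degree bound `d`; v0: prime fields
only). Typical arguments: `C := PRel`, `D := NPRel`, `BPPRel`, ….
[Aaronson–Wigderson 2009, Def. 1.2 (1)] [cite: AaronsonWigderson2009, Def. 1.2 (1] -/
def IsAlgebrizingInclusion (C D : Oracle → Set (Language Bool)) : Prop :=
  ∀ (A : Language Bool) (Ã : ExtensionOracle) (d : ℕ), Ã.IsExtensionOf A d →
    C (Oracle.ofLanguage A) ⊆ D Ã.toOracle

/-- The separation `C ⊄ D` of relativisable classes *algebrizes* if `C^Ã ⊄ D^A` for every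
oracle language `A` and every low-degree extension `Ã` of `A` (any degree bound `d`; v0: prime
fields only). [Aaronson–Wigderson 2009, Def. 1.2 (2)] [cite: AaronsonWigderson2009, Def. 1.2 (2] -/
def IsAlgebrizingSeparation (C D : Oracle → Set (Language Bool)) : Prop :=
  ∀ (A : Language Bool) (Ã : ExtensionOracle) (d : ℕ), Ã.IsExtensionOf A d →
    ¬ C Ã.toOracle ⊆ D (Oracle.ofLanguage A)

/-- Sanity consequence of `exists_isExtensionOf_one`: an algebrizing inclusion `C ⊆ D` yields,
for every oracle language `A`, some multilinear extension `Ã` with `C^A ⊆ D^Ã` (so the notion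
is never vacuous). [Aaronson–Wigderson 2009, §1.2 and §4.1] [cite: AaronsonWigderson2009, §1.2 and §4.1] -/
def IsAlgebrizingInclusion.exists_subset : Prop :=
  ∀ {C D : Oracle → Set (Language Bool)} (h : IsAlgebrizingInclusion C D) (A : Language Bool),
    ∃ Ã : ExtensionOracle, Ã.IsExtensionOf A 1 ∧ C (Oracle.ofLanguage A) ⊆ D Ã.toOracle

/- interim proof relied on results that are now named facts (D-0014); demoted to a fact by the M5 import, proof preserved:
:= by
  obtain ⟨Ã, hÃ⟩ := exists_isExtensionOf_one A
  exact ⟨Ã, hÃ, h A Ã 1 hÃ⟩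
-/

end Literature.Computability.Complexity
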